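import Literature.MathematicalPhysics.QuantumFieldTheory.BalabanImbrieJaffe1984to88.BIJ85Claim73AllCouplings
import Literature.MathematicalPhysics.QuantumFieldTheory.BalabanImbrieJaffe1984to88.BIJ85Thm711Torus

/-!
# `BalabanImbrieJaffe1984to88.BIJ85MeanFieldAction41` — T. Bałaban, J. Imbrie, A. Jaffe, *Renormalization of the Higgs model: minimizers,
propagators and the stability of mean field theory*, Commun. Math. Phys. **97** (1985) 299–329 [BalabanImbrieJaffe1985], **(4.1)** p. 309 (and its
first-step instance **(3.8)** p. 306): the MEAN FIELD ACTION `½⟨f^{(k)}, σ_kf^{(k)}⟩ + ½⟨ψ, Δ_k(u_k)ψ⟩` of the `k`-th effective action, TYPED as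
a definition with body on the torus carriers of record, with the printed stability sentences attached by name (Theorem 7.1.1 for `σ_k`,
(7.3.1) ⇒ (7.3.2) for `Δ_k(u_k)`).

statement-level skeleton of published theorems with citation tags; proofs where landed; nothing here is a claim about the Yang–Mills mass gap

PDF held: `paper:balaban1985-cmp97-bij-higgs-minimizers` (journal page = PDF page + 298); pp. 301, 306, 309, 310 [PDF 3, 8, 11, 12] read on the
text layer (`lit read … --pages 3,8-12`).

CITATION HEADER (lean-in-tree rule).  Part of the lit-balaban TYPED SKELETON (HOME `run/shared/lean/pub/lit-balaban/`), unit `lit-balaban-r15`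
gen 11 (reader/typer and fold owner of C1 = [BalabanImbrieJaffe1985]).  Serves rows `C1.Eq4.1` and `C1.Eq3.8` of `HOME/lit-balaban-r15/ROWS-C1.md`
(until now «absent»: (4.1) = «sum with unnamed interaction terms — no statement; its named parts are typed», (3.8) = «structure display»);
the named parts are rows `C1.Eq4.2.4-4.2.7` ((4.2.4)–(4.2.5): `f^{(k)}`, `½⟨f^{(k)}, σ_kf^{(k)}⟩`), `C1.Eq4.2.1-4.2.2` (`σ_k`), `C1.Eq4.6.2-4.6.4`
(`Δ_k(u_k)`), `C1.Eq4.5.4` (`u_k`); the stability sentences are rows `C1.Thm7.1.1` and `C1.Eq7.3.1-7.3.2`.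

THE PRINTED TEXT.  p. 309 [PDF 11], verbatim: *"action is the sum of two parts: a gauge field action and a scalar field part which is quadratic in
φ and depends on an average value of the gauge field. There are further interaction terms between the gauge field and the scalar field, but these
interactions yield small corrections to our mean field action and are not considered here. … The action has the form S_k(v, ψ) = ½⟨f^{(k)},
σ_kf^{(k)}⟩ + ½⟨ψ, Δ_k(u_k)ψ⟩ + interaction terms, (4.1) where the interaction terms will be considered in detail in a later paper."*  p. 306
[PDF 8], verbatim: *"This will yield a Gaussian approximation to the integral (3.1) and a corresponding quadratic form for S^{(1)}. The quadratic form
has the structure S_Q^{(1)} = ½⟨f^{(1)}, σ₁f^{(1)}⟩ + ½⟨ψ, Δ₁(u₁)ψ⟩ (3.8) which we now derive and analyze. In particular we will establish strict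
positivity of σ₁ and Δ₁(u₁) in (3.8)."*  p. 301 [PDF 3]: *"We study the quadratic terms which arise by iteration of the renormalization
transformation, yielding S_{Q1}, S_{Q2}, …, S_{Qk}, and establish uniform stability estimates (strictly positive lower bounds) on the S_Q's."*  p. 310
[PDF 12]: *"Define the plaquette field f^{(k)} on the unit lattice by f^{(k)}(p) = (ie_k)^{−1} ln v(∂p), where e_k = e(L^kε)^{(4−d)/2}. (4.2.4) The
quadratic part of the action for the gauge field is then ½⟨f^{(k)}, σ_kf^{(k)}⟩. (4.2.5)"*.

WHAT IS TYPED (definitions with bodies; no `Prop`-valued fact).  The DOMAIN is p33's hypothesis-free index `BIJ85Claim73AllCouplings.AllIdx d L`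
of ALL actual Sect. 7.3 data — a torus `P` of record with `P.d = d`, `P.L = L`, a scale `1 ≤ k ≤ m + K`, a coupling `0 < e_k ≤ 1`, a unit-lattice
`U(1)` field `v` on `T₁^{(k)}` — at which every ingredient of (4.1) is an object of record: **`fk i`** = `f^{(k)} = (ie_k)^{−1} ln v(∂·)` ((4.2.4),
branch (2.11): `BIJ85SmallFieldSplit64.plaqField`, in the Euclidean encoding `BIJ85Sigma421Torus.toU` of the unit-lattice plaquette space — the
field p33's `smoothX`/(4.5.4) use), **`gaugePart i`** = `½⟨f^{(k)}, σ_kf^{(k)}⟩` ((4.2.5), `σ_k` = p30's `BIJ85Sigma421Torus.sigmaTorus` at weight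
`η^d` and curl factor `L^k = η⁻¹`, the operator of r15's `Thm711` torus head `BIJ85Thm711Torus.sigmaFormTorus`), **`scalarPart a i ψ`** =
`½⟨ψ, Δ_k(u_k)ψ⟩` (p33's `allStabData a ha i` — `Δ_k(u_k)` of (4.6.4) with the printed `a_k`, p11's `deltaOp`, THE inverse `G_k(u_k)` (4.6.2), at the
ACTUAL background `u_k` (4.5.4) computed from `v`), and **`meanFieldAction a i ψ := gaugePart i + scalarPart a i ψ`** — the displayed explicit part
of (4.1), the paper's *"mean field action"*; **(3.8)** `S_Q^{(1)}` is its instance at `k = 1` (`meanFieldAction_one`; at `k = 1` the Sect. 4 operators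
are Sect. 3's: `G_{1,Ax} = C`, (4.2.2) = (3.21) p. 310, `a₁ = a` `BIJ85Sect4Statements.aK_one`).
WHAT IS PROVED (by name).  `meanFieldAction_eq` (the printed shape), `gaugePart_nonneg`, `gaugePart_pos` (*"strict positivity of σ₁"*, every k:
p33's `inner_sigmaTorus_pos`), **`meanFieldAction_stability`** — the p. 301 sentence *"uniform stability estimates (strictly positive lower bounds)
on the S_Q's"* in the printed currency: constants `c = 2·c711(d) > 0` (Theorem 7.1.1, r15's torus head `thm711_sigmaTorus`, p33 g5 p256165), `γ > 0`,
`α > 0`, `M < ∞` ((7.3.1) ⇒ (7.3.2) first form for every coupling, p33 g11 `claim73_allCouplings` p321379) chosen BEFORE the torus, the scale, the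
coupling and the fields, such that for every index `i` satisfying (7.3.1) and every `ψ`:
`½·c‖f^{(k)}‖² + ½(γΣ_b|u_k(b)ψ(b₊) − ψ(b₋)|² − M e_k^{2−α}Σ_x|ψ(x)|²) ≤ meanFieldAction a i ψ`; `meanFieldAction_stability_one` (the (3.8) sentence
*"strict positivity of σ₁ and Δ₁(u₁)"* = the instance `k = 1`).
HONEST SCOPE.  The «interaction terms» of (4.1) are NOT an object of this paper (*"considered in detail in a later paper"* =
[BalabanImbrieJaffe1988]) and are not typed; `S_k(v, ψ)` itself is therefore not typed — only its displayed mean-field part.  The identification of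
`meanFieldAction` with the small-field expansion of the renormalized action (Sect. 6, rows `C1.Eq6.1.1`, `C1.Eq6.3.1-6.3.4`) is the paper's
derivation and is not re-proved here.  Imports: Literature + Mathlib only; standard axioms.
-/

namespace Literature.MathematicalPhysics.QuantumFieldTheory.BalabanImbrieJaffe1984to88.BIJ85MeanFieldAction41

open Literature.MathematicalPhysics.QuantumFieldTheory.Balaban1983to89 hiding Site Plaq
open BIJ85Sect7Statements (ScalarStabData)
open BIJ85Claim73AllCouplings (AllIdx allStabData claim73_allCouplings)
open BIJ85Sigma421Torus (UnitPlaqSpace toU sigmaTorus)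
open BIJ85Thm711Torus (thm711_sigmaTorus eta_pow_d_pos)
open BIJ85SigmaPositivity (inner_sigmaTorus_pos)
open BIJ85SigmaClosedCube (c711 c711_pos)
open BIJ85SmallFieldSplit64 (plaqField)
open scoped BigOperators RealInnerProductSpace
open Finset

noncomputable section

variable {d L : ℕ}

/-! ## §1  The ingredients of (4.1) at an index of ALL actual data -/

/-- **(4.2.4)** *"f^{(k)}(p) = (ie_k)^{−1} ln v(∂p)"* — the plaquette field of the index's unit-lattice `U(1)` field `v` (branch (2.11):
`plaqField i.e i.v`), as an element of the Euclidean unit-lattice plaquette space of `T₁^{(k)}` (`toU`). [cite: BalabanImbrieJaffe1985, (4.2.4) p.310] -/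
def fk (i : AllIdx d L) : UnitPlaqSpace i.P i.k := toU i.P i.k (plaqField i.e i.v)

/-- kernel: the coordinates of `fk i` are the printed values `(ie_k)^{−1} ln v(∂p)`. [cite: BalabanImbrieJaffe1985, (4.2.4) p.310] -/
theorem fk_apply (i : AllIdx d L) (p : Balaban1983to89.Plaq i.P i.k) : fk i p = plaqField i.e i.v p := rfl

/-- `σ_k` OF RECORD on the index's torus: p30's `sigmaTorus` at weight `η^d` and curl factor `L^k = η⁻¹` (the operator of the `Thm711` torus head
`BIJ85Thm711Torus.sigmaFormTorus`). [cite: BalabanImbrieJaffe1985, (4.2.2) p.310] -/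
def sigmaK (i : AllIdx d L) : UnitPlaqSpace i.P i.k →ₗ[ℝ] UnitPlaqSpace i.P i.k :=
  sigmaTorus (P := i.P) i.hd2 (i.P.eta i.k ^ i.P.d) ((i.P.L : ℝ) ^ i.k) i.k

/-- **(4.2.5)** *"The quadratic part of the action for the gauge field is then ½⟨f^{(k)}, σ_kf^{(k)}⟩"*. [cite: BalabanImbrieJaffe1985, (4.2.5) p.310] -/
def gaugePart (i : AllIdx d L) : ℝ := (1 / 2) * ⟪fk i, sigmaK i (fk i)⟫

/-- **the scalar field part** `½⟨ψ, Δ_k(u_k)ψ⟩` of (4.1) (p. 309: *"a scalar field part which is quadratic in φ and depends on an average value of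
the gauge field"*): `⟨ψ, Δ_k(u_k)ψ⟩` is the form of p33's actual Sect. 7.3 datum `allStabData a ha i` — `Δ_k(u_k)` of (4.6.4) with the printed `a_k`,
THE inverse `G_k(u_k)` (4.6.2), at the actual background `u_k` (4.5.4) computed from `v`. [cite: BalabanImbrieJaffe1985, (4.1) p.309] -/
def scalarPart (a : ℝ) (ha : 0 < a) (i : AllIdx d L) (ψ : (allStabData a ha i).Scalar) : ℝ :=
  (1 / 2) * (allStabData a ha i).deltaForm ψ

/-! ## §2  (4.1): the mean field action; (3.8) its first-step instance -/

/-- **(4.1)** p. 309 [PDF 11], verbatim: *"The action has the form S_k(v, ψ) = ½⟨f^{(k)}, σ_kf^{(k)}⟩ + ½⟨ψ, Δ_k(u_k)ψ⟩ + interaction terms, (4.1)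
where the interaction terms will be considered in detail in a later paper."* — THE MEAN FIELD ACTION (the displayed explicit part; p. 309 *"our mean
field action"*) of the pair `(v, ψ)` = (the index's `U(1)` field, a unit-lattice scalar field), for the printed constant `a > 0` of (4.6.4).  The
«interaction terms» are not an object of this paper and are not typed. [cite: BalabanImbrieJaffe1985, (4.1) p.309] -/
def meanFieldAction (a : ℝ) (ha : 0 < a) (i : AllIdx d L) (ψ : (allStabData a ha i).Scalar) : ℝ :=
  gaugePart i + scalarPart a ha i ψ

/-- **(4.1) as printed**: `meanFieldAction = ½⟨f^{(k)}, σ_kf^{(k)}⟩ + ½⟨ψ, Δ_k(u_k)ψ⟩`. [cite: BalabanImbrieJaffe1985, (4.1) p.309] -/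
theorem meanFieldAction_eq (a : ℝ) (ha : 0 < a) (i : AllIdx d L) (ψ : (allStabData a ha i).Scalar) :
    meanFieldAction a ha i ψ = (1 / 2) * ⟪fk i, sigmaK i (fk i)⟫ + (1 / 2) * (allStabData a ha i).deltaForm ψ := rfl

/-- **(3.8)** p. 306 [PDF 8], verbatim: *"The quadratic form has the structure S_Q^{(1)} = ½⟨f^{(1)}, σ₁f^{(1)}⟩ + ½⟨ψ, Δ₁(u₁)ψ⟩ (3.8) which we now
derive and analyze."* — `S_Q^{(1)}` IS the mean field action (4.1) at the first step `k = 1` (p. 310: *"if k = 1, then G_{k,Ax} = C and (4.2.2)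
agrees with (3.21)"*; `a₁ = a`, `BIJ85Sect4Statements.aK_one`): for an index with `i.k = 1` the typed (3.8) is `meanFieldAction a ha i`.
[cite: BalabanImbrieJaffe1985, (3.8) p.306] -/
def SQone (a : ℝ) (ha : 0 < a) (i : AllIdx d L) (_hk : i.k = 1) (ψ : (allStabData a ha i).Scalar) : ℝ :=
  meanFieldAction a ha i ψ

/-- kernel: (3.8) = (4.1) at `k = 1`, by definition. [cite: BalabanImbrieJaffe1985, (3.8) p.306] -/
theorem meanFieldAction_one (a : ℝ) (ha : 0 < a) (i : AllIdx d L) (hk : i.k = 1) (ψ : (allStabData a ha i).Scalar) :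
    SQone a ha i hk ψ = (1 / 2) * ⟪fk i, sigmaK i (fk i)⟫ + (1 / 2) * (allStabData a ha i).deltaForm ψ := rfl

/-! ## §3  The stability sentences, by name -/

/-- The gauge part is non-negative (Theorem 7.1.1 on the torus, `thm711_sigmaTorus`). [cite: BalabanImbrieJaffe1985, (4.2.3) p.310] -/
theorem gaugePart_nonneg (i : AllIdx d L) : 0 ≤ gaugePart i := by
  have h := thm711_sigmaTorus (P := i.P) i.hd2 i.hk (c := (i.P.L : ℝ) ^ i.k)
    (pow_ne_zero _ (Nat.cast_ne_zero.2 i.P.L_pos.ne')) (fk i)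
  have hc : 0 ≤ 2 * c711 i.P.d * ‖fk i‖ ^ 2 := by
    have := c711_pos (show 0 < i.P.d by have := i.hd2; omega)
    positivity
  unfold gaugePart sigmaK
  linarith

/-- *"strict positivity of σ₁"* (p. 306), every `k`: the gauge part is `> 0` unless `f^{(k)} = 0` (p33's `inner_sigmaTorus_pos`).
[cite: BalabanImbrieJaffe1985, (3.8) p.306] -/
theorem gaugePart_pos (i : AllIdx d L) (hf : fk i ≠ 0) : 0 < gaugePart i := by
  have h := inner_sigmaTorus_pos (P := i.P) i.hd2 i.hk (eta_pow_d_pos i.P i.k) (c := (i.P.L : ℝ) ^ i.k)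
    (pow_ne_zero _ (Nat.cast_ne_zero.2 i.P.L_pos.ne')) hf
  unfold gaugePart sigmaK
  linarith

/-- **"uniform stability estimates (strictly positive lower bounds) on the S_Q's"** (p. 301) for the typed mean field action, in the printed
currency of Theorem 7.1.1 and (7.3.2): for every dimension `d ≥ 2`, block size `L`, printed `a > 0` and exponent `𝓅` there are constants `c > 0`
(`= 2·c711(d)`), `γ > 0`, `α > 0`, `M` chosen BEFORE the torus, the scale, the coupling and the fields such that for EVERY actual datum `i` (every
torus with `P.d = d`, `P.L = L`, every `1 ≤ k ≤ m + K`, every `0 < e_k ≤ 1`, every `v`) satisfying (7.3.1) at `𝓅`, and every scalar field `ψ`: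
`½c‖f^{(k)}‖² + ½(γΣ_b|u_k(b)ψ(b₊) − ψ(b₋)|² − Me_k^{2−α}Σ_x|ψ(x)|²) ≤ ½⟨f^{(k)}, σ_kf^{(k)}⟩ + ½⟨ψ, Δ_k(u_k)ψ⟩` — Theorem 7.1.1 (`thm711_sigmaTorus`,
torus head p256165) and (7.3.1) ⇒ (7.3.2) first form for all couplings (`claim73_allCouplings`, p321379), combined.
[cite: BalabanImbrieJaffe1985, (4.1) p.309] -/
theorem meanFieldAction_stability (hd : 2 ≤ d) (a : ℝ) (ha : 0 < a) (pexp : ℝ) :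
    ∃ c γ α M : ℝ, 0 < c ∧ 0 < γ ∧ 0 < α ∧
      ∀ i : AllIdx d L, (allStabData a ha i).Hyp731 pexp →
        ∀ ψ : (allStabData a ha i).Scalar,
          (1 / 2) * (c * ‖fk i‖ ^ 2) +
              (1 / 2) * (γ * (∑ b, (allStabData a ha i).covDiffSq ψ b) -
                M * (allStabData a ha i).ek ^ (2 - α) * (∑ x, (allStabData a ha i).absSq ψ x)) ≤
            meanFieldAction a ha i ψ := by
  obtain ⟨γ, α, M, hγ, hα, h⟩ := claim73_allCouplings (d := d) (L := L) hd a ha pexp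
  refine ⟨2 * c711 d, γ, α, M, by have := c711_pos (show 0 < d by omega); positivity, hγ, hα, fun i hi ψ => ?_⟩
  have h1 := thm711_sigmaTorus (P := i.P) i.hd2 i.hk (c := (i.P.L : ℝ) ^ i.k)
    (pow_ne_zero _ (Nat.cast_ne_zero.2 i.P.L_pos.ne')) (fk i)
  have h2 := h i hi ψ
  have hcd : c711 i.P.d = c711 d := by rw [i.hd]
  rw [hcd] at h1
  unfold meanFieldAction gaugePart scalarPart sigmaK
  linarith

/-- **(3.8)'s sentence *"we will establish strict positivity of σ₁ and Δ₁(u₁)"*** — the instance `k = 1` of `meanFieldAction_stability` for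
`S_Q^{(1)}` (same constants). [cite: BalabanImbrieJaffe1985, (3.8) p.306] -/
theorem meanFieldAction_stability_one (hd : 2 ≤ d) (a : ℝ) (ha : 0 < a) (pexp : ℝ) :
    ∃ c γ α M : ℝ, 0 < c ∧ 0 < γ ∧ 0 < α ∧
      ∀ (i : AllIdx d L) (hk : i.k = 1), (allStabData a ha i).Hyp731 pexp →
        ∀ ψ : (allStabData a ha i).Scalar,
          (1 / 2) * (c * ‖fk i‖ ^ 2) +
              (1 / 2) * (γ * (∑ b, (allStabData a ha i).covDiffSq ψ b) -
                M * (allStabData a ha i).ek ^ (2 - α) * (∑ x, (allStabData a ha i).absSq ψ x)) ≤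
            SQone a ha i hk ψ := by
  obtain ⟨c, γ, α, M, hc, hγ, hα, h⟩ := meanFieldAction_stability (d := d) (L := L) hd a ha pexp
  exact ⟨c, γ, α, M, hc, hγ, hα, fun i _ hi ψ => h i hi ψ⟩

end

end Literature.MathematicalPhysics.QuantumFieldTheory.BalabanImbrieJaffe1984to88.BIJ85MeanFieldAction41
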